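import Literature.AlgebraicGeometry.Resolution.KiralyLutkebohmertCriterionProofs
import HarnessLib

/-!
# Invariants of a regular local ring under an automorphism of prime order with principal
# augmentation ideal are regular — discharge of `KiralyLutkebohmert2013_thm2`

`Literature.RingTheory.RegularLocalRing.KiralyLutkebohmert2013_thm2` (file
`Literature/RingTheory/RegularLocalRing/KiralyLutkebohmert.lean`) is the named fact: for a regular
local ring `B`, a prime `p` and a ring automorphism `σ ≠ 1` with `σ ^ p = 1` whose augmentation
ideal `(σ b - b ; b ∈ B)` is principal, the ring of invariants `B^σ` is a regular local ring
(Király–Lütkebohmert 2013, Theorem 2, (a) ⟹ (b) ⟹ (c) ⟹ (d)). It is PROVED here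
(`KiralyLutkebohmert2013_thm2_holds`) by chaining the discharged first and second parts of
Theorem 2 (`KiralyLutkebohmert2013_thm2_first_holds`, `KiralyLutkebohmert2013_thm2_second_holds` of
`Literature/AlgebraicGeometry/Resolution/KiralyLutkebohmertCriterionProofs.lean`) through the
tree's `KiralyLutkebohmert2013_thm2_regular_of_isPrincipal`. This file only exists to keep the
discharge in the namespace of its fact (the proofs live on the `AlgebraicGeometry/Resolution`
side, which imports the Proposition-5 file of this directory). No new named facts.

## References

* [KiralyLutkebohmert2013] F. Király, W. Lütkebohmert, *Group actions of prime order on local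
  normal rings*, Algebra & Number Theory 7:1 (2013) 63–74, Theorem 2.
-/

namespace Literature.RingTheory.RegularLocalRing

/-- **Discharge of `KiralyLutkebohmert2013_thm2` (Király–Lütkebohmert 2013, Theorem 2,
(a) ⟹ (d) for regular local rings).** [cite: KiralyLutkebohmert2013, Thm. 2, pp. 63–68] -/
theorem KiralyLutkebohmert2013_thm2_holds : KiralyLutkebohmert2013_thm2 := by
  intro p hp B _ _ σ hσ hσp hP
  exact Literature.AlgebraicGeometry.Resolution.KiralyLutkebohmert2013_thm2_regular_of_isPrincipal
    Literature.AlgebraicGeometry.Resolution.KiralyLutkebohmert2013_thm2_first_holds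
    Literature.AlgebraicGeometry.Resolution.KiralyLutkebohmert2013_thm2_second_holds
    p hp B σ hσ hσp hP

end Literature.RingTheory.RegularLocalRing
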